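import Literature.Analysis.FluidPDE.AnomalousDissipationTwoHalfD
import Literature.Analysis.FluidPDE.BrueDeLellisAnomalousDissipation
import HarnessLib

/-!
# Bruè–De Lellis' Theorem 3.1 from the Alberti–Crippa–Mazzucato blocks

Topic `Analysis/FluidPDE`, theorems only (no new definition, no named fact). The vendored
`BrueDeLellis2023_thm31` (`AnomalousDissipationTwoHalfD.lean`; Bruè–De Lellis, Comm. Math. Phys. 400
(2023) = arXiv:2207.06301v1, §3.1 Thm. 3.1 p. 6) is reduced to the same kinematic leaf as the vendored
Theorem 1.1 (`brue_deLellis_anomalous_dissipation_of_compatible_blocks`, `BrueDeLellisAnomalousDissipation.lean`):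

  `acm_compatible_blocks → BrueDeLellis2023_thm31` (`BrueDeLellis2023_thm31_of_compatible_blocks`),

so that what remains for `BrueDeLellis2023_thm31_holds` is exactly `acm_compatible_blocks_holds`
(Alberti–Crippa–Mazzucato 2019, §8: the two generating moves of the Peano snake).

The witnesses are those of the tree's proof of Theorem 1.1 (source §5; Cheskidov 2023 §§3–4): the glued
planar drifts `v^m = Gluing.drift v m`, Cheskidov's viscosities `ν_m = (m+1)^{7/4} λ_m⁻²`, the planar
forces `g^m = ∂ₜv^m + (v^m·∇)v^m - ν_mΔv^m` (`Torus.nsBodyForce`), the viscous scalars `θ^m` from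
`ρ_in = ρ₀(0)` (parabolic well-posedness), planar datum `v₀ = 0`. What this file ADDS to the proof of
Theorem 1.1 is clause (1) of Theorem 3.1 — the CONVERGENCE `g^m → g` in `C([0,1]; C^α(T²))` for every
`α ∈ (0,1)` to the limit force `g = Gluing.limForce v` (the Euler force of the moving block, `0` from
`t = 1` on; source, Lemma 5.1 "Moreover, `g^m → g` in `C([0,1];C^α(T²))`", (5.3)):

* `BrueDeLellis2023.tendsto_iSup_eBoundedHolderNorm_nsBodyForce_sub_limForce` —
  `sup_{t∈[0,1]} ‖g^m(t) - g(t)‖_{C^{0,α}} → 0`: on the gluing interval of a block `j ≤ m` the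
  difference is the viscous term `ν_mΔ(block j)`, `O(poly(m) λ_m^{α-1})` in `C^{0,α}`
  (`eBoundedHolderNorm_viscous_le_sharp`, `tendsto_viscHolderErr`); for `t ∈ [t_{m+1}, 1)` it is the
  Euler force of the moving block `blockIdx t ≥ m+1`, `O(poly(j) λ_j^{α-1})`, `j > m`
  (`Gluing.blockForce_bounds`, `Gluing.tendsto_profileForceBound`); both vanish at and after `t = 1`;
* `BrueDeLellis2023.continuousInHolderOn_limForce` — `g ∈ C([0,1]; C^{0,α}(T²))`: near `t₀ < 1` the
  limit force is one of the smooth forces (`Gluing.limForce_eq_nsBodyForce_of_lt`), at `t₀ = 1` its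
  `C^{0,α}` norm tends to `0 = ‖g(1)‖` (the Hölder twin of `Gluing.continuousInLpOn_limForce`);
* `BrueDeLellis2023.isClassicalNSSolutionOn_drift_nsBodyForce` — `(v^m, 0)` is a classical planar
  Navier–Stokes solution with force `g^m` (by definition of `g^m`);
* the assembly `BrueDeLellis2023_thm31_of_blocks` (total dissipation `‖θ^m(1)‖ → 0` exactly as in
  `brue_deLellis_anomalous_dissipation_of_blocks`, giving (3.4) with `ε = 1/4`) and its corollaries
  `_of_acm_family`, `_of_acm_building_blocks`, `_of_compatible_blocks`.

## References

* E. Bruè, C. De Lellis, Comm. Math. Phys. 400 (2023) 1507–1533, arXiv:2207.06301v1: §3.1 Thm. 3.1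
  p. 6, Thm. 4.1 p. 8, §5 (5.1)–(5.4) and Lemma 5.1 p. 10. [`BrueDeLellisCMP2023`]
* A. Cheskidov, arXiv:2311.04182 (2023), Thm. 3.1, §3 (3.4)–(3.13), §4 (4.2)–(4.13). [`Cheskidov2023`]
* G. Alberti, G. Crippa, A. L. Mazzucato, J. Amer. Math. Soc. 32 (2019), §8. [`AlbertiCrippaMazzucato2019`]
-/

noncomputable section

open MeasureTheory Set Filter
open _root_.Topology
open scoped ENNReal NNReal InnerProductSpace

namespace Literature.Analysis.FluidPDE

namespace BrueDeLellis2023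

open Gluing Literature.Analysis.FunctionSpaces
open Literature.Analysis.FunctionSpaces.Torus (twoHalf planarProj)

section Holder

variable {d : Type*} [Fintype d] [DecidableEq d] [Nonempty d]
variable {ρ : ℕ → ℝ → UnitAddTorus d → ℝ} {v : ℕ → ℝ → UnitAddTorus d → EuclideanSpace ℝ d}
variable {A Bσ Bσ' : ℝ}

/-- The block Euler forces are bounded in `C^{0,r}`, `r < 1`, by a null sequence of the block index
(Bruè–De Lellis 2023, Lemma 5.1: `‖∂ₜṽₙ + ṽₙ·∇ṽₙ‖_{C^α} ≲ poly(n) λₙ^{α-1}`; `Gluing.blockForce_bounds`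
with `Gluing.tendsto_profileForceBound`). [cite: BrueDeLellisCMP2023, Lemma 5.1] -/
theorem exists_blockForce_holder_bound (hB : Blocks ρ v) (hK : BlockDerivBounds v A)
    (hBσ : ∀ n t, |deriv (sigma n) t| ≤ Bσ / tau n)
    (hBσ' : ∀ n t, |deriv (deriv (sigma n)) t| ≤ Bσ' / tau n ^ 2) {r : ℝ≥0} (hr : r < 1) :
    ∃ G : ℕ → ℝ, Tendsto G atTop (𝓝 0) ∧
      ∀ (n : ℕ) (t : ℝ), eBoundedHolderNorm r (blockForce v n t) ≤ ENNReal.ofReal (G n) := by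
  have hr' : r ≤ 1 := hr.le
  have hrr : (r : ℝ) < 1 := by exact_mod_cast hr
  have hA := hK.nonneg
  have hB0' := nonneg_of_abs_deriv_deriv_sigma_le hBσ'
  have hv : ∀ n, Torus.IsSmoothSpaceTimeOn (Icc 0 1) (v n) := fun n => (hB.sol n).smooth_velocity
  set A₁ : ℝ := Bσ' * A + Bσ ^ 2 * (A + Fintype.card d * A ^ 2) with hA₁
  set A₂ : ℝ := Bσ' * A + Bσ ^ 2 * (A + 2 * Fintype.card d * A ^ 2) with hA₂
  set G : ℕ → ℝ := fun n => (((n : ℝ) + 1) * (n + 2)) ^ 2 * (5 ^ n)⁻¹ * A₁ +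
      (Real.sqrt (Fintype.card d) * (Fintype.card d * ((((n : ℝ) + 1) * (n + 2)) ^ 2 * A₂))) ^ (r : ℝ) *
        (2 * ((((n : ℝ) + 1) * (n + 2)) ^ 2 * (5 ^ n)⁻¹ * A₁)) ^ (1 - (r : ℝ)) with hG
  have hGlim : Tendsto G atTop (𝓝 0) := by
    have := tendsto_profileForceBound (A₁ := A₁) (A₂ := A₂)
      (c := Real.sqrt (Fintype.card d) * Fintype.card d) (r := r)
      (by positivity) (by positivity) (by positivity) hrr
    refine this.congr fun n => ?_
    simp only [hG]; ring_nf
  exact ⟨G, hGlim, fun n t => (blockForce_bounds (hv n) hK hBσ hBσ' t hr').2⟩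

omit [Nonempty d] in
/-- The viscous terms `ν_m Δ(block n)`, `n ≤ m`, are bounded in `C^{0,r}`, `r < 1`, by a null sequence
of `m` (Bruè–De Lellis 2023, (5.4): `ν_q‖Δv^q‖_{C^α} ≲ poly λ_q^{α-1}`; `eBoundedHolderNorm_viscous_le_sharp`
with `tendsto_viscHolderErr`). [cite: BrueDeLellisCMP2023, §5 (5.4) and Lemma 5.1] -/
theorem exists_viscous_holder_bound (hB : Blocks ρ v) (hK : BlockDerivBounds v A)
    (hBσ : ∀ n t, |deriv (sigma n) t| ≤ Bσ / tau n) {r : ℝ≥0} (hr : r < 1) :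
    ∃ Vb : ℕ → ℝ, Tendsto Vb atTop (𝓝 0) ∧
      ∀ (m n : ℕ), n ≤ m → ∀ t : ℝ,
        eBoundedHolderNorm r
            (fun x => Cheskidov2023.visc m • Torus.laplacian (blockDrift v n t) x) ≤
          ENNReal.ofReal (Vb m) := by
  have hr' : r ≤ 1 := hr.le
  have hrr : (r : ℝ) < 1 := by exact_mod_cast hr
  have hv : ∀ n, Torus.IsSmoothSpaceTimeOn (Icc 0 1) (v n) := fun n => (hB.sol n).smooth_velocity
  set d' : ℝ := (Fintype.card d : ℝ) with hd'
  set a : ℝ := Real.sqrt d' * d' ^ 2 * A with ha_def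
  set b : ℝ := 2 * d' * A with hb_def
  set Vb : ℕ → ℝ := fun m => Cheskidov2023.visc m * (Bσ * (((m : ℝ) + 1) * (m + 2))) *
      (d' * A * 5 ^ m + a ^ (r : ℝ) * b ^ (1 - (r : ℝ)) * ((5 : ℝ) ^ m) ^ (1 + (r : ℝ))) with hVb
  have hVlim : Tendsto Vb atTop (𝓝 0) := tendsto_viscHolderErr hrr
  exact ⟨Vb, hVlim, fun m n hnm t =>
    eBoundedHolderNorm_viscous_le_sharp (hv n) hK hBσ hnm (Cheskidov2023.visc_pos m).le t hr'⟩

/-- **`g^m → g` in `C([0,1]; C^{0,r}(T^d))`, `r < 1`** (Bruè–De Lellis 2023, Lemma 5.1, second half;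
Thm. 3.1 (1)): `sup_{t ∈ [0,1]} ‖g^m(t) - g(t)‖_{C^{0,r}} → 0` for the Navier–Stokes forces
`g^m = nsBodyForce ν_m (drift v m)` of the glued drifts with Cheskidov's viscosities and the limit force
`g = limForce v`. On `[t_j, t_{j+1})`, `j ≤ m`, `g^m - g = -ν_mΔ(block j)` (`Gluing.nsBodyForce_drift_eq`);
on `[t_{m+1}, 1)`, `g^m = 0` and `g` is the force of the moving block `blockIdx t ≥ m + 1`; from `t = 1`
on both vanish. [cite: BrueDeLellisCMP2023, Lemma 5.1 and Thm. 3.1 (1)] -/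
theorem tendsto_iSup_eBoundedHolderNorm_nsBodyForce_sub_limForce (hB : Blocks ρ v)
    (hK : BlockDerivBounds v A) (hBσ : ∀ n t, |deriv (sigma n) t| ≤ Bσ / tau n)
    (hBσ' : ∀ n t, |deriv (deriv (sigma n)) t| ≤ Bσ' / tau n ^ 2) {r : ℝ≥0} (hr : r < 1) :
    Tendsto (fun m => ⨆ t ∈ Icc (0 : ℝ) 1,
      eBoundedHolderNorm r (Torus.nsBodyForce (Cheskidov2023.visc m) (drift v m) t - limForce v t))
      atTop (𝓝 0) := by
  classical
  obtain ⟨G, hG, hGb⟩ := exists_blockForce_holder_bound hB hK hBσ hBσ' hr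
  obtain ⟨Vb, hVb, hVbb⟩ := exists_viscous_holder_bound hB hK hBσ hr
  rw [ENNReal.tendsto_nhds_zero]
  intro ε hε
  by_cases hε' : ε = ⊤
  · exact Eventually.of_forall fun m => hε' ▸ le_top
  have hδ : 0 < ε.toReal := ENNReal.toReal_pos hε.ne' hε'
  have hεeq : ENNReal.ofReal ε.toReal = ε := ENNReal.ofReal_toReal hε'
  have hV' : ∀ᶠ m in atTop, Vb m ≤ ε.toReal := hVb.eventually (Iic_mem_nhds hδ)
  obtain ⟨J, hJ⟩ := eventually_atTop.1 (hG.eventually (Iic_mem_nhds hδ))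
  filter_upwards [hV', eventually_ge_atTop J] with m hmV hmJ
  refine iSup₂_le fun t ht => ?_
  rcases lt_or_ge t (tn (m + 1)) with hlt | hge
  · -- both forces are carried by the block `blockIdx t ≤ m`
    have ht1 : t < 1 := hlt.trans (tn_lt_one _)
    have hmem := mem_Ico_tn_blockIdx ht.1 ht1
    have hjm : blockIdx t ≤ m := blockIdx_le_of_lt_tn_succ hlt
    have hfun : Torus.nsBodyForce (Cheskidov2023.visc m) (drift v m) t - limForce v t =
        (-1 : ℝ) • fun x => Cheskidov2023.visc m • Torus.laplacian (blockDrift v (blockIdx t) t) x := by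
      funext x
      rw [Pi.sub_apply, Pi.smul_apply, nsBodyForce_drift_eq hB _ hjm hmem x, limForce, if_pos ⟨ht.1, ht1⟩,
        neg_one_smul]
      abel
    rw [hfun, eBoundedHolderNorm_const_smul]
    simp only [enorm_neg, enorm_one, one_mul]
    calc eBoundedHolderNorm r (fun x => Cheskidov2023.visc m • Torus.laplacian (blockDrift v (blockIdx t) t) x)
        ≤ ENNReal.ofReal (Vb m) := hVbb m (blockIdx t) hjm t
      _ ≤ ENNReal.ofReal ε.toReal := ENNReal.ofReal_le_ofReal hmV
      _ = ε := hεeq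
  · -- `g^m(t) = 0`; the limit force is the force of a block of index `≥ m + 1 ≥ J`, or `0`
    have hzero : Torus.nsBodyForce (Cheskidov2023.visc m) (drift v m) t = 0 := by
      funext x; exact nsBodyForce_drift_eq_zero hB _ (Or.inr hge) x
    have hneg : (0 : UnitAddTorus d → EuclideanSpace ℝ d) - limForce v t = (-1 : ℝ) • limForce v t := by
      rw [neg_one_smul, zero_sub]
    rw [hzero, hneg, eBoundedHolderNorm_const_smul]
    simp only [enorm_neg, enorm_one, one_mul]
    rcases lt_or_ge t 1 with ht1 | ht1
    · have hidx : m + 1 ≤ blockIdx t := le_blockIdx_of_tn_le hge ht1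
      have hJle : J ≤ blockIdx t := le_trans hmJ (le_trans (Nat.le_succ m) hidx)
      have hlf : limForce v t = blockForce v (blockIdx t) t := by
        funext x; rw [limForce, if_pos ⟨ht.1, ht1⟩]
      rw [hlf]
      calc eBoundedHolderNorm r (blockForce v (blockIdx t) t)
          ≤ ENNReal.ofReal (G (blockIdx t)) := hGb _ _
        _ ≤ ENNReal.ofReal ε.toReal := ENNReal.ofReal_le_ofReal (hJ _ hJle)
        _ = ε := hεeq
    · rw [limForce_eq_zero_of_one_le v ht1, eBoundedHolderNorm_zero]
      exact bot_le

/-- **The limit force is continuous in time with values in `C^{0,r}(T^d)` on `[0,1]`, `r < 1`**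
(Bruè–De Lellis 2023, Thm. 3.1 (1): `g ∈ ⋂_{α<1} C([0,1]; C^α)`): near `t₀ < 1` it is one of the smooth
forces (`Gluing.limForce_eq_nsBodyForce_of_lt` and `continuousInHolderOn_of_isSmoothSpaceTimeOn`); at
`t₀ = 1` its `C^{0,r}` norm is that of the moving block's force, which decays along the blocks, and
`g(1) = 0` (the Hölder twin of `Gluing.continuousInLpOn_limForce`). [cite: BrueDeLellisCMP2023, Thm. 3.1 (1) and Lemma 5.1] -/
theorem continuousInHolderOn_limForce (hB : Blocks ρ v) (hK : BlockDerivBounds v A)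
    (hBσ : ∀ n t, |deriv (sigma n) t| ≤ Bσ / tau n)
    (hBσ' : ∀ n t, |deriv (deriv (sigma n)) t| ≤ Bσ' / tau n ^ 2) {r : ℝ≥0} (hr : r < 1) :
    ContinuousInHolderOn (Icc 0 1) r (limForce v) := by
  classical
  obtain ⟨G, hG, hGb⟩ := exists_blockForce_holder_bound hB hK hBσ hBσ' hr
  have hmem : ∀ t ∈ Icc (0 : ℝ) 1, MemBoundedHolder r (limForce v t) := by
    intro t ht
    rcases lt_or_ge t 1 with ht1 | ht1
    · have hlf : limForce v t = blockForce v (blockIdx t) t := by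
        funext x; rw [limForce, if_pos ⟨ht.1, ht1⟩]
      rw [MemBoundedHolder, hlf]
      exact (hGb _ _).trans_lt ENNReal.ofReal_lt_top
    · rw [MemBoundedHolder, limForce_eq_zero_of_one_le v ht1, eBoundedHolderNorm_zero]
      exact ENNReal.zero_lt_top
  refine ⟨hmem, fun t₀ ht₀ => ?_⟩
  rcases lt_or_ge t₀ 1 with h1 | h1
  · -- locally one of the smooth forces
    obtain ⟨m, hm⟩ : ∃ m : ℕ, t₀ < tn (m + 1) :=
      ((tendsto_tn.comp (tendsto_add_atTop_nat 1)).eventually (Ioi_mem_nhds h1)).exists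
    have hF : Torus.IsSmoothSpaceTimeOn (Icc 0 1) (Torus.nsBodyForce 0 (drift v m)) :=
      (isSmoothSpaceTimeOn_nsBodyForce_drift hB 0 m).mono (subset_univ _)
    have hc := (continuousInHolderOn_of_isSmoothSpaceTimeOn zero_lt_one hF hr).2 t₀ ht₀
    refine hc.congr' ?_
    have hev : ∀ᶠ s in 𝓝[Icc 0 1] t₀, s < tn (m + 1) := mem_nhdsWithin_of_mem_nhds (Iio_mem_nhds hm)
    filter_upwards [hev] with s hs
    rw [limForce_eq_nsBodyForce_of_lt hB hs, limForce_eq_nsBodyForce_of_lt hB hm]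
  · -- the blow-up time `t₀ = 1`
    have ht₀1 : t₀ = 1 := le_antisymm ht₀.2 h1
    subst ht₀1
    rw [ENNReal.tendsto_nhds_zero]
    intro ε hε
    by_cases hε' : ε = ⊤
    · exact Eventually.of_forall fun _ => hε' ▸ le_top
    have hδ : 0 < ε.toReal := ENNReal.toReal_pos hε.ne' hε'
    obtain ⟨J, hJ⟩ := eventually_atTop.1 (hG.eventually (Iic_mem_nhds hδ))
    have hev : ∀ᶠ s in 𝓝[Icc 0 1] (1 : ℝ), tn J < s :=
      mem_nhdsWithin_of_mem_nhds (Ioi_mem_nhds (tn_lt_one J))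
    filter_upwards [hev, self_mem_nhdsWithin] with s hs hsI
    rw [limForce_eq_zero_of_one_le v le_rfl, sub_zero]
    rcases lt_or_ge s 1 with hs1 | hs1
    · have hlf : limForce v s = blockForce v (blockIdx s) s := by
        funext x; rw [limForce, if_pos ⟨hsI.1, hs1⟩]
      rw [hlf]
      calc eBoundedHolderNorm r (blockForce v (blockIdx s) s)
          ≤ ENNReal.ofReal (G (blockIdx s)) := hGb _ _
        _ ≤ ENNReal.ofReal ε.toReal := ENNReal.ofReal_le_ofReal (hJ _ (le_blockIdx_of_tn_le hs.le hs1))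
        _ = ε := ENNReal.ofReal_toReal hε'
    · rw [limForce_eq_zero_of_one_le v hs1, eBoundedHolderNorm_zero]
      exact bot_le

omit [Nonempty d] in
/-- **The glued drift solves the planar Navier–Stokes system with its own body force**: for every
`ν`, `(v^m, q ≡ 0)` is a classical solution on `[0,1] × T^d` of `∂ₜv + (v·∇)v + ∇q = νΔv + g` with
`g = nsBodyForce ν (drift v m) = ∂ₜv^m + (v^m·∇)v^m - νΔv^m` (Bruè–De Lellis 2023, (5.4): "the body force
generated by `v^m` in the Navier–Stokes equations"; Cheskidov 2023, (3.13)). [cite: BrueDeLellisCMP2023, §5 (5.4)] -/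
theorem isClassicalNSSolutionOn_drift_nsBodyForce (hB : Blocks ρ v) (ν : ℝ) (m : ℕ) :
    Torus.IsClassicalNSSolutionOn (Icc 0 1) ν (Torus.nsBodyForce ν (drift v m)) (drift v m)
      (fun _ _ => (0 : ℝ)) where
  smooth_velocity := (isSmoothSpaceTimeOn_drift hB m).mono (subset_univ _)
  smooth_pressure := Torus.isSmoothSpaceTimeOn_const (Torus.isSmooth_const (0 : ℝ)) _
  momentum t ht x := by
    have h2 : Torus.gradient (fun _ : UnitAddTorus d => (0 : ℝ)) x = 0 :=
      gradient_fun_const (0 : EuclideanSpace ℝ d) (0 : ℝ)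
    rw [(isSmoothSpaceTimeOn_drift hB m).timeDerivWithin_eq_of_subset (subset_univ _)
      (uniqueDiffOn_Icc zero_lt_one) ht x, Torus.nsBodyForce_apply, h2, sub_zero]
    abel
  divFree t _ := isDivFree_drift hB m t

end Holder

end BrueDeLellis2023

/-! ## The assembly -/

open Gluing BrueDeLellis2023 Literature.Analysis.FunctionSpaces in
open Literature.Analysis.FunctionSpaces.Torus (twoHalf planarProj) in
/-- **Bruè–De Lellis' Theorem 3.1 from the glued blocks and parabolic well-posedness.** From blocks
`(ρₙ, vₙ)` on `T²` handed over continuously (`Gluing.Blocks`), with the scalar clauses of Thm. 4.1 (b)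
and the velocity bounds `Gluing.BlockDerivBounds` of Thm. 4.1 (a), and classical parabolic
well-posedness on `T²`, the fact `BrueDeLellis2023_thm31` follows with the witnesses of §5:
`ν_m = (m+1)^{7/4}λ_m⁻²` (strictly decreasing), `g^m = ∂ₜv^m + (v^m·∇)v^m - ν_mΔv^m`, `v₀ = 0`,
`θ₀ = ρ₀(0)`, `v^m = Gluing.drift v m` with zero planar pressure (`isClassicalNSSolutionOn_drift_nsBodyForce`),
the viscous scalars `θ^m`; clause (1) with `g = Gluing.limForce v` by
`tendsto_iSup_eBoundedHolderNorm_nsBodyForce_sub_limForce` and `continuousInHolderOn_limForce`;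
clause (2)/(3.4) with `ε = 1/4`, since `2ν_m ∫₀¹ ‖∇θ^m‖² = 1 - ‖θ^m(1)‖²` and `‖θ^m(1)‖² → 0`
(total dissipation, verbatim the argument of `brue_deLellis_anomalous_dissipation_of_blocks`). [cite: BrueDeLellisCMP2023, Thm. 3.1, Thm. 4.1 and §5 (5.1)–(5.4)] -/
theorem BrueDeLellis2023_thm31_of_blocks
    {ρb : ℕ → ℝ → UnitAddTorus (Fin 2) → ℝ}
    {vb : ℕ → ℝ → UnitAddTorus (Fin 2) → EuclideanSpace ℝ (Fin 2)} {A : ℝ} (hB : Gluing.Blocks ρb vb)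
    (hb : ∀ n : ℕ, ∀ s ∈ Icc (0 : ℝ) 1,
      Torus.HasZeroMean (ρb n s) ∧ ∫ x, ρb n s x ^ 2 = 1 ∧ ∀ x, |ρb n s x| ≤ 10)
    (hCH : ∃ C : ℝ, ∀ n : ℕ, ∀ s ∈ Icc (0 : ℝ) 1,
      (∀ x, ‖Torus.gradient (ρb n s) x‖ ≤ C * 5 ^ n) ∧
      Torus.eHomSobolevSeminorm (-1) (fun x => (ρb n s x : ℂ)) ≤ ENNReal.ofReal (C * (5 ^ n)⁻¹))
    (hK : Gluing.BlockDerivBounds vb A)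
    (hwp : Torus.exists_unique_isClassicalScalarTransportForcedOn (d := Fin 2)) :
    BrueDeLellis2023_thm31 := by
  classical
  obtain ⟨C, hCH⟩ := hCH
  have hgrad : ∀ n : ℕ, ∀ s ∈ Icc (0 : ℝ) 1, ∀ x, ‖Torus.gradient (ρb n s) x‖ ≤ C * 5 ^ n :=
    fun n s hs => (hCH n s hs).1
  have hH : ∀ n : ℕ, ∀ s ∈ Icc (0 : ℝ) 1,
      Torus.eHomSobolevSeminorm (-1) (fun x => (ρb n s x : ℂ)) ≤ ENNReal.ofReal (C * (5 ^ n)⁻¹) :=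
    fun n s hs => (hCH n s hs).2
  have h01 : (0 : ℝ) ∈ Icc (0 : ℝ) 1 := ⟨le_rfl, zero_le_one⟩
  have hC0 : 0 ≤ C := by
    have := hgrad 0 0 h01 0
    simp only [pow_zero, mul_one] at this
    exact (norm_nonneg _).trans this
  obtain ⟨Bσ, -, hBσ⟩ := exists_forall_abs_deriv_sigma_le
  obtain ⟨Bσ', -, hBσ'⟩ := exists_forall_abs_deriv_deriv_sigma_le
  have hvS : ∀ m, Torus.IsSmoothSpaceTimeOn univ (drift vb m) := isSmoothSpaceTimeOn_drift hB
  -- the datum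
  set ρin : UnitAddTorus (Fin 2) → ℝ := ρb 0 0 with hρin
  have hρin_smooth : Torus.IsSmooth ρin := (hB.sol 0).smooth_scalar.isSmooth_slice h01
  have hρin_sq : ∫ x, ρin x ^ 2 = 1 := (hb 0 0 h01).2.1
  -- the viscous scalars `θ^m` on `[0,2]` (parabolic well-posedness; BDL (3.12), Cheskidov (4.2))
  have hex : ∀ m : ℕ, ∃ θ : ℝ → UnitAddTorus (Fin 2) → ℝ,
      Torus.IsClassicalScalarTransportOn (Icc 0 2) (Cheskidov2023.visc m) (drift vb m) θ ∧ θ 0 = ρin :=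
    fun m => by
    obtain ⟨θ, hθ, h0, -⟩ := Torus.exists_unique_isClassicalScalarTransportOn_of_forced hwp
      (Cheskidov2023.visc_pos m) two_pos ((hvS m).mono (subset_univ _))
      (fun t _ => isDivFree_drift hB m t) hρin_smooth
    exact ⟨θ, hθ, h0⟩
  choose θ hθ hθ0 using hex
  /- ### Total dissipation `‖θ^m(1)‖² → 0` (verbatim the argument of
  `brue_deLellis_anomalous_dissipation_of_blocks`) -/
  have hρcl : ∀ m, Torus.IsClassicalScalarTransportOn (Icc 0 2) 0 (drift vb m) (profile ρb m) :=
    fun m => isClassicalScalarTransportOn_profile hB m (uniqueDiffOn_Icc two_pos)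
  have hsame : ∀ m, θ m 0 = profile ρb m 0 := fun m => by rw [hθ0 m, profile_zero]
  have htn2 : ∀ m, tn (m + 1) < 2 := fun m => (tn_lt_one _).trans one_lt_two
  have hI1 : ∀ m, Icc (0 : ℝ) (tn (m + 1)) ⊆ Icc 0 2 := fun m => Icc_subset_Icc le_rfl (htn2 m).le
  have hI2 : ∀ m, Icc (tn (m + 1)) 2 ⊆ Icc (0 : ℝ) 2 := fun m => Icc_subset_Icc (tn_nonneg _) le_rfl
  have hE0 : ∀ m, ∀ t ∈ Icc (0 : ℝ) 2, ∫ x, θ m t x ^ 2 ≤ 1 := fun m t ht => by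
    have h : Torus.scalarL2Sq (θ m t) ≤ Torus.scalarL2Sq (θ m 0) :=
      (hθ m).antitoneOn_scalarL2Sq (Cheskidov2023.visc_pos m).le (subset_refl (Icc (0 : ℝ) 2))
        ⟨le_rfl, zero_le_two⟩ ht ht.1
    have h0 : Torus.scalarL2Sq (θ m 0) = 1 := by rw [hθ0 m]; exact hρin_sq
    rw [h0] at h
    exact h
  set E1 : ℕ → ℝ := fun m => Cheskidov2023.visc m * (C ^ 2 * (2 * 25 ^ m * tau m)) with hE1_def
  have hE1 : ∀ m, ∀ t ∈ Icc (0 : ℝ) (tn (m + 1)), ∫ x, (θ m t x - profile ρb m t x) ^ 2 ≤ E1 m :=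
    fun m t ht => by
    have h := (hθ m).integral_sub_sq_le_of_mem_Icc (hρcl m) (Cheskidov2023.visc_pos m).le (hI1 m) (hsame m) ht
    have hdiss := scalarDissipation_profile_le hB hgrad (Cheskidov2023.visc_pos m).le m
    have hnn : 0 ≤ Torus.scalarDissipation (Cheskidov2023.visc m) (profile ρb m) 0 (tn (m + 1)) :=
      Torus.scalarDissipation_nonneg (Cheskidov2023.visc_pos m).le _ (tn_nonneg _)
    linarith
  have hE1_tendsto : Tendsto E1 atTop (𝓝 0) := Cheskidov2023.tendsto_visc_mul_tau C
  have hdrift0 : ∀ m, ∀ t ∈ Icc (tn (m + 1)) (2 : ℝ), drift vb m t = 0 := fun m t ht =>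
    drift_eq_zero_of_ge vb ht.1
  have h1mem : ∀ m, (1 : ℝ) ∈ Icc (tn (m + 1)) 2 := fun m => ⟨(tn_lt_one _).le, one_le_two⟩
  set RHS : ℕ → ℝ≥0∞ := fun m =>
    2 * ENNReal.ofReal (E1 m) +
      2 * (ENNReal.ofReal ((Cheskidov2023.freqCut m : ℝ) ^ 2) * ENNReal.ofReal (C * (5 ^ m)⁻¹) ^ 2) +
      ENNReal.ofReal (Real.exp (-(8 * Real.pi ^ 2 * Cheskidov2023.visc m *
        (Cheskidov2023.freqCut m : ℝ) ^ 2) * (1 - tn (m + 1)))) with hRHS_def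
  have hkey : ∀ m, eLpNorm (θ m 1) 2 volume ^ 2 ≤ RHS m := fun m => by
    have hT₁ : tn (m + 1) ∈ Icc (0 : ℝ) 2 := ⟨tn_nonneg _, (htn2 m).le⟩
    have hθT : Torus.IsSmooth (θ m (tn (m + 1))) := (hθ m).smooth_scalar.isSmooth_slice hT₁
    obtain ⟨hprof, hmean1, hH1⟩ := profile_tn_succ hB hb hH m
    have hρT : Torus.IsSmooth (profile ρb m (tn (m + 1))) := by
      rw [hprof]; exact (hB.sol m).smooth_scalar.isSmooth_slice ⟨zero_le_one, le_rfl⟩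
    have hsplit := (hθ m).eLpNorm_sq_le_lowModes_add_exp (Cheskidov2023.visc_pos m).le (htn2 m) (hI2 m)
      (hdrift0 m) (Cheskidov2023.freqCut m) (h1mem m)
    have hlow := Torus.lowModes_le_two_mul_add (Cheskidov2023.freqCut m) (hθT.memLp 2) (hρT.memLp 2)
    have hlowρ : Torus.lowModes (Cheskidov2023.freqCut m) (profile ρb m (tn (m + 1))) ≤
        ENNReal.ofReal ((Cheskidov2023.freqCut m : ℝ) ^ 2) * ENNReal.ofReal (C * (5 ^ m)⁻¹) ^ 2 := by
      rw [hprof]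
      exact Torus.lowModes_le_of_eHomSobolevSeminorm_le hmean1 hH1 (Cheskidov2023.freqCut m)
    have hdiff : eLpNorm (θ m (tn (m + 1)) - profile ρb m (tn (m + 1))) 2 volume ^ 2 ≤
        ENNReal.ofReal (E1 m) := by
      rw [Cheskidov2023.eLpNorm_sq_eq_ofReal_integral_sq ((hθT.sub hρT).memLp 2)]
      exact ENNReal.ofReal_le_ofReal (hE1 m _ ⟨tn_nonneg _, le_rfl⟩)
    have henergy : eLpNorm (θ m (tn (m + 1))) 2 volume ^ 2 ≤ 1 := by
      rw [Cheskidov2023.eLpNorm_sq_eq_ofReal_integral_sq (hθT.memLp 2), ← ENNReal.ofReal_one]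
      exact ENNReal.ofReal_le_ofReal (hE0 m _ hT₁)
    calc eLpNorm (θ m 1) 2 volume ^ 2
        ≤ Torus.lowModes (Cheskidov2023.freqCut m) (θ m (tn (m + 1))) +
            ENNReal.ofReal (Real.exp (-(8 * Real.pi ^ 2 * Cheskidov2023.visc m *
              (Cheskidov2023.freqCut m : ℝ) ^ 2) * (1 - tn (m + 1)))) *
              eLpNorm (θ m (tn (m + 1))) 2 volume ^ 2 := hsplit
      _ ≤ (2 * ENNReal.ofReal (E1 m) +
            2 * (ENNReal.ofReal ((Cheskidov2023.freqCut m : ℝ) ^ 2) * ENNReal.ofReal (C * (5 ^ m)⁻¹) ^ 2)) +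
            ENNReal.ofReal (Real.exp (-(8 * Real.pi ^ 2 * Cheskidov2023.visc m *
              (Cheskidov2023.freqCut m : ℝ) ^ 2) * (1 - tn (m + 1)))) * 1 := by
          gcongr
          calc Torus.lowModes (Cheskidov2023.freqCut m) (θ m (tn (m + 1)))
              ≤ 2 * eLpNorm (θ m (tn (m + 1)) - profile ρb m (tn (m + 1))) 2 volume ^ 2 +
                  2 * Torus.lowModes (Cheskidov2023.freqCut m) (profile ρb m (tn (m + 1))) := hlow
            _ ≤ 2 * ENNReal.ofReal (E1 m) +
                2 * (ENNReal.ofReal ((Cheskidov2023.freqCut m : ℝ) ^ 2) * ENNReal.ofReal (C * (5 ^ m)⁻¹) ^ 2) := by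
                gcongr
      _ = RHS m := by rw [mul_one]
  have hRHS : Tendsto RHS atTop (𝓝 0) := by
    have t1 : Tendsto (fun m => 2 * ENNReal.ofReal (E1 m)) atTop (𝓝 0) := by
      have h := ENNReal.tendsto_ofReal hE1_tendsto
      rw [ENNReal.ofReal_zero] at h
      simpa using ENNReal.Tendsto.const_mul h (Or.inr ENNReal.ofNat_ne_top)
    have t2 : Tendsto (fun m => 2 * (ENNReal.ofReal ((Cheskidov2023.freqCut m : ℝ) ^ 2) *
        ENNReal.ofReal (C * (5 ^ m)⁻¹) ^ 2)) atTop (𝓝 0) := by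
      have h := ENNReal.tendsto_ofReal (Cheskidov2023.tendsto_freqCut_sq_mul C)
      rw [ENNReal.ofReal_zero] at h
      have h' : Tendsto (fun m => ENNReal.ofReal ((Cheskidov2023.freqCut m : ℝ) ^ 2) *
          ENNReal.ofReal (C * (5 ^ m)⁻¹) ^ 2) atTop (𝓝 0) := by
        refine h.congr fun m => ?_
        rw [← ENNReal.ofReal_pow (mul_nonneg hC0 (by positivity)), ← ENNReal.ofReal_mul (sq_nonneg _)]
      simpa using ENNReal.Tendsto.const_mul h' (Or.inr ENNReal.ofNat_ne_top)
    have t3 : Tendsto (fun m => ENNReal.ofReal (Real.exp (-(8 * Real.pi ^ 2 * Cheskidov2023.visc m *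
        (Cheskidov2023.freqCut m : ℝ) ^ 2) * (1 - tn (m + 1))))) atTop (𝓝 0) := by
      have h := ENNReal.tendsto_ofReal Cheskidov2023.tendsto_exp_heat
      rwa [ENNReal.ofReal_zero] at h
    have h := (t1.add t2).add t3
    rw [add_zero, add_zero] at h
    exact h
  have hsq_tendsto : Tendsto (fun m => eLpNorm (θ m 1) 2 volume ^ 2) atTop (𝓝 0) :=
    tendsto_of_tendsto_of_tendsto_of_le_of_le tendsto_const_nhds hRHS (fun m => zero_le) hkey
  have h12 : (1 : ℝ) ∈ Icc (0 : ℝ) 2 := ⟨zero_le_one, one_le_two⟩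
  have hone : Tendsto (fun m => ∫ x, θ m 1 x ^ 2) atTop (𝓝 0) := by
    have h := (ENNReal.tendsto_toReal ENNReal.zero_ne_top).comp hsq_tendsto
    rw [ENNReal.toReal_zero] at h
    refine h.congr fun m => ?_
    have h1 : Torus.IsSmooth (θ m 1) := (hθ m).smooth_scalar.isSmooth_slice h12
    rw [Function.comp_apply, Cheskidov2023.eLpNorm_sq_eq_ofReal_integral_sq (h1.memLp 2),
      ENNReal.toReal_ofReal (integral_nonneg fun x => sq_nonneg _)]
  -- the energy identity on `[0,1]`: `2ν_m ∫₀¹ ‖∇θ^m‖² = 1 - ‖θ^m(1)‖²`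
  have hid : ∀ m, 2 * Cheskidov2023.visc m * ∫ t in (0 : ℝ)..1, Torus.scalarGradNormSq (θ m t) =
      1 - ∫ x, θ m 1 x ^ 2 := by
    intro m
    have h := Torus.IsClassicalScalarTransportOn.scalarL2Sq_add_scalarDissipation_holds (hθ m) zero_le_one
      (Icc_subset_Icc le_rfl one_le_two)
    simp only [Torus.scalarDissipation, Torus.scalarL2Sq, hθ0 m] at h
    have h2 := hρin_sq
    linarith
  have hev_diss : ∀ᶠ m in atTop,
      (1 : ℝ) / 4 ≤ Cheskidov2023.visc m * ∫ t in (0 : ℝ)..1, Torus.scalarGradNormSq (θ m t) := by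
    have hlt : ∀ᶠ m in atTop, ∫ x, θ m 1 x ^ 2 < 1 / 2 := hone (Iio_mem_nhds (by norm_num))
    filter_upwards [hlt] with m hm
    have := hid m
    linarith
  /- ### The witnesses of Theorem 3.1 -/
  refine ⟨Cheskidov2023.visc, fun m => Torus.nsBodyForce (Cheskidov2023.visc m) (drift vb m), 0, ρin,
    fun m => drift vb m, fun _ _ _ => 0, θ, isVanishingViscosity_visc, Torus.isSmooth_const _, hρin_smooth,
    fun m => (isSmoothSpaceTimeOn_nsBodyForce_drift hB _ m).mono (subset_univ _), ?_, ?_, ?_⟩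
  · -- (1): the limit force and the convergence in `C([0,1]; C^α(T²))`, `α ∈ (0,1)`
    refine ⟨limForce vb, fun α _ hα1 => ?_⟩
    have hcont := continuousInHolderOn_limForce hB hK hBσ hBσ' hα1
    exact ⟨hcont.1, hcont, tendsto_iSup_eBoundedHolderNorm_nsBodyForce_sub_limForce hB hK hBσ hBσ' hα1⟩
  · -- (2): the planar Navier–Stokes solutions and the transported scalars, with their data
    intro m
    refine ⟨isClassicalNSSolutionOn_drift_nsBodyForce hB _ m, drift_eq_zero_of_nonpos vb le_rfl,
      (hθ m).restrict (Icc_subset_Icc le_rfl one_le_two) (uniqueDiffOn_Icc zero_lt_one), hθ0 m⟩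
  · -- (3.4) with `ε = 1/4`
    refine ⟨1 / 4, by norm_num, ?_⟩
    filter_upwards [hev_diss] with m hm
    unfold Torus.scalarDissipation
    exact hm

/-- **Theorem 3.1 from the Alberti–Crippa–Mazzucato family** (`alberti_crippa_mazzucato_family`,
`QuasiSelfSimilarMixing.lean`; source, Thm. 4.1 with item (c) per level): parabolic well-posedness is the
proved `Torus.exists_unique_isClassicalScalarTransportForcedOn_holds`, the velocity bounds come from
`Gluing.exists_blockDerivBounds`. [cite: BrueDeLellisCMP2023, Thm. 3.1 and Thm. 4.1] -/
theorem BrueDeLellis2023_thm31_of_acm_family (h : alberti_crippa_mazzucato_family) :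
    BrueDeLellis2023_thm31 := by
  obtain ⟨ρ, v, hsol, ha, ha', hb, hC, -, hd⟩ := h
  obtain ⟨A, hK⟩ := Gluing.exists_blockDerivBounds (fun n => (hsol n).smooth_velocity) ha ha'
  exact BrueDeLellis2023_thm31_of_blocks ⟨hsol, hd⟩ hb hC hK
    Torus.exists_unique_isClassicalScalarTransportForcedOn_holds

/-- **Theorem 3.1 from the structural building-block fact** `acm_building_blocks`
(`QuasiSelfSimilarBuildingBlocks.lean`), through `alberti_crippa_mazzucato_family_of_building_blocks`. [cite: BrueDeLellisCMP2023, Thm. 3.1, §4.1 and Thm. 4.1] -/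
theorem BrueDeLellis2023_thm31_of_acm_building_blocks (h : acm_building_blocks) :
    BrueDeLellis2023_thm31 :=
  BrueDeLellis2023_thm31_of_acm_family (alberti_crippa_mazzucato_family_of_building_blocks h)

/-- **Theorem 3.1 from the compatible blocks of the Peano snake** (`acm_compatible_blocks`,
Alberti–Crippa–Mazzucato 2019, §8.1, §8.4 (a)–(c), §8.6): what remains for `BrueDeLellis2023_thm31_holds`
is exactly `acm_compatible_blocks_holds`, the same leaf as for `brue_deLellis_anomalous_dissipation`.
[cite: BrueDeLellisCMP2023, Thm. 3.1 and Thm. 4.1] [cite: AlbertiCrippaMazzucato2019, §8.1, §8.4, §8.6] -/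
theorem BrueDeLellis2023_thm31_of_compatible_blocks (h : acm_compatible_blocks) :
    BrueDeLellis2023_thm31 :=
  BrueDeLellis2023_thm31_of_acm_building_blocks (acm_building_blocks_of_compatible_blocks h)

end Literature.Analysis.FluidPDE

end
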